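import Summits.CriticalPhenomena.SAWScalingLimit.Theorems.SAWDefectDecoherenceBoundaryClosureRZigzagHalfLattice
import Literature.Probability.RandomPlanarGeometry.HexParafermionSpinShift
import Mathlib.Analysis.SpecialFunctions.Complex.Arg
import HarnessLib

/-!
# Crux `BoundaryClosureR` (stmt-CriticalPhenomena-14004), line `polygon-parity-squeeze`:
# lattice geometry at a corner (support for the corner phase relation `sidePhase_corner`,
# sub-goal (A1b') of `stub_polygonIdentification`)

Elementary facts used to run the winding along the two sides of an exact lattice corner:

* `mem_ball_of_between` — lattice points `p + b·d` between two points `p + a·d`, `p + c·d` of a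
  Euclidean ball lie in the ball (convexity); `hexMidpoint_floor_eq`, `hexMidpoint_side3_eq`,
  `hexMidpoint_side2_eq` — the dart midpoints of a floor / of a column of form `3` / of form `2`
  form such arithmetic progressions (steps `1`, `ζ`, `ζ`);
* `dart_coord_zero`, `dart_coord_three`, `dart_coord_two` — a dart of `ℍ` is determined up to its
  cell by its direction: heading `-90°` it is `(j,m,0) → (j,m-1,1)`, heading `-30°` it is
  `(c,y,1) → (c+1,y,0)`, heading `150°` it is `(c,y,0) → (c-1,y,1)` (the dangling directions
  `-(1/√3)·innerNormal k` of the forms `k = 0, 3, 2`);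
* `dist_hexCenter_le_of_adj` (`1/√3 ≤ 3/5`), `mem_ball_of_dist_le` (shrunken balls), `near_floor`,
  `near_side3`, `near_side2` (the faces at a dart whose midpoint is deep in a ball lie in the ball);
* `arg_innerNormal_three_div_zero = π/3`, `arg_innerNormal_two_div_zero = -2π/3` — the signed
  turnings `arg (n_{k'}/n_k)` at the corners of forms `(0,3)` and `(0,2)`.

No definition is introduced.
-/

noncomputable section

open Literature.Probability.LatticeModels Literature.Probability.RandomPlanarGeometry
open Literature.Probability.RandomPlanarGeometry.SAW
open Summit.CriticalPhenomena.SAWScalingLimit.Theorems.ObservableToSLE.FloorRatio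
  (dist_hexCenter_hexMidpoint_le)

namespace Summit.CriticalPhenomena.SAWScalingLimit.Theorems.PolygonParitySqueeze

namespace SidePhaseCorner

/-! ### 1. Arithmetic progressions of lattice points in a ball -/

/-- **Between two points of a ball, along an arithmetic progression, one stays in the ball**
(convexity of Euclidean balls). [folklore] -/
theorem mem_ball_of_between {p d x : ℂ} {R : ℝ} {a b c : ℤ} (ha : p + (a : ℂ) * d ∈ Metric.ball x R)
    (hc : p + (c : ℂ) * d ∈ Metric.ball x R) (hab : a ≤ b) (hbc : b ≤ c) :
    p + (b : ℂ) * d ∈ Metric.ball x R := by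
  rcases eq_or_lt_of_le (hab.trans hbc) with hac | hac
  · have hba : b = a := le_antisymm (hac ▸ hbc) hab
    rw [hba]; exact ha
  · have hca : (0 : ℝ) < (c : ℝ) - a := by exact_mod_cast sub_pos.2 hac
    have hθ0 : 0 ≤ ((b : ℝ) - a) / ((c : ℝ) - a) :=
      div_nonneg (by exact_mod_cast sub_nonneg.2 hab) hca.le
    have hθ1 : ((b : ℝ) - a) / ((c : ℝ) - a) ≤ 1 :=
      (div_le_one hca).2 (by exact_mod_cast sub_le_sub_right hbc a)
    have hθC : ((b : ℂ) - a) / ((c : ℂ) - a) * ((c : ℂ) - a) = (b : ℂ) - a :=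
      div_mul_cancel₀ _ (sub_ne_zero.2 (by exact_mod_cast hac.ne'))
    have key : p + (b : ℂ) * d = (1 - ((b : ℝ) - a) / ((c : ℝ) - a)) • (p + (a : ℂ) * d) +
        (((b : ℝ) - a) / ((c : ℝ) - a)) • (p + (c : ℂ) * d) := by
      rw [Complex.real_smul, Complex.real_smul]
      push_cast
      linear_combination (-d) * hθC
    rw [key]
    exact (convex_ball x R) ha hc (sub_nonneg.2 hθ1) hθ0 (by ring)

/-- A point at distance `≤ s` from a point of `ball x (r - s)` lies in `ball x r`. [folklore] -/
theorem mem_ball_of_dist_le {z m x : ℂ} {r s : ℝ} (hm : m ∈ Metric.ball x (r - s))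
    (hd : dist z m ≤ s) : z ∈ Metric.ball x r := by
  rw [Metric.mem_ball] at hm ⊢
  linarith [dist_triangle z m x]

/-- Adjacent faces of `ℍ` have centres at distance `1/√3 ≤ 3/5`. [folklore] -/
theorem dist_hexCenter_le_of_adj {a b : HexVertex} (h : hexGraph.Adj a b) :
    dist (hexCenter a) (hexCenter b) ≤ 3 / 5 := by
  rw [dist_comm, Complex.dist_eq, norm_hexCenter_sub_of_adj h,
    inv_le_comm₀ (Real.sqrt_pos.2 (by norm_num)) (by norm_num), Real.le_sqrt (by norm_num)]
  all_goals norm_num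

/-- An endpoint of a dart `{v, t}` of `ℍ` is within `1/2` of its midpoint. [folklore] -/
theorem dist_hexCenter_hexMidpoint_mk_le {v t z : HexVertex} (h : hexGraph.Adj v t)
    (hz : z = v ∨ z = t) : dist (hexCenter z) (hexMidpoint s(v, t)) ≤ 1 / 2 := by
  refine dist_hexCenter_hexMidpoint_le ((SimpleGraph.mem_edgeSet hexGraph).2 h) ?_
  rcases hz with rfl | rfl
  · exact Sym2.mem_mk_left _ _
  · exact Sym2.mem_mk_right _ _

/-! ### 2. The dart midpoints of the three sides are arithmetic progressions -/

/-- Floor darts of row `m`: midpoints `mid₀ + k`. [folklore] -/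
theorem hexMidpoint_floor_eq (k m : ℤ) :
    hexMidpoint s(((![k, m - 1], 1) : HexVertex), ((![k, m], 0) : HexVertex)) =
      hexMidpoint s(((![0, m - 1], 1) : HexVertex), ((![0, m], 0) : HexVertex)) + (k : ℂ) * 1 := by
  simp [hexCenter, triEmbed]; ring

/-- Darts of a column of form `3` (`x₀ = c`): midpoints `mid₀ + y ζ`. [folklore] -/
theorem hexMidpoint_side3_eq (c y : ℤ) :
    hexMidpoint s(((![c + 1, y], 0) : HexVertex), ((![c, y], 1) : HexVertex)) =
      hexMidpoint s(((![c + 1, 0], 0) : HexVertex), ((![c, 0], 1) : HexVertex)) + (y : ℂ) * triZeta := by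
  simp [hexCenter, triEmbed]; ring

/-- Darts of a column of form `2` (`x₀ = c`): midpoints `mid₀ + y ζ`. [folklore] -/
theorem hexMidpoint_side2_eq (c y : ℤ) :
    hexMidpoint s(((![c - 1, y], 1) : HexVertex), ((![c, y], 0) : HexVertex)) =
      hexMidpoint s(((![c - 1, 0], 1) : HexVertex), ((![c, 0], 0) : HexVertex)) + (y : ℂ) * triZeta := by
  simp [hexCenter, triEmbed]; ring

/-! ### 3. Darts from their directions -/

/-- **A dart heading `-90°` is a floor dart**: if `c_t - c_v = -(1/√3)·n₀ = -i/√3` for adjacent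
faces `v, t`, then `v = (j,m,0)` and `t = (j,m-1,1)`. [folklore] -/
theorem dart_coord_zero {v t : HexVertex} (hadj : hexGraph.Adj v t)
    (hdir : hexCenter t - hexCenter v = -((1 / Real.sqrt 3 : ℝ) : ℂ) * innerNormal 0) :
    ∃ j m : ℤ, v = (![j, m], 0) ∧ t = (![j, m - 1], 1) := by
  have h3 : 0 < Real.sqrt 3 := Real.sqrt_pos.2 (by norm_num)
  rw [one_div, neg_inv_sqrt_three_mul_innerNormal] at hdir
  simp only [Matrix.cons_val_zero] at hdir
  obtain ⟨x, i⟩ := v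
  obtain ⟨y, l⟩ := t
  obtain ⟨j, m, rfl⟩ : ∃ j m : ℤ, x = ![j, m] := ⟨x 0, x 1, by rw [site_two_eq_iff]; simp⟩
  fin_cases i <;> fin_cases l <;> simp only [Fin.zero_eta, Fin.mk_one, Fin.isValue] at hadj hdir ⊢
  · exact absurd hadj (not_hexGraph_adj_of_snd_eq_holds _ _ rfl)
  · rcases (hexGraph_adj_iff_of_snd_eq_zero_holds _ y).1 hadj with rfl | rfl | rfl
    · rw [(hexCenter_sub_up _).1] at hdir
      have h := congrArg Complex.re hdir; norm_num at h
    · rw [(hexCenter_sub_up _).2.1] at hdir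
      have h := congrArg Complex.re hdir; norm_num at h
    · exact ⟨j, m, rfl, Prod.ext (by rw [site_two_eq_iff]; simp) rfl⟩
  · rcases (hexGraph_adj_iff_of_snd_eq_one _ y).1 hadj with rfl | rfl | rfl
    · rw [(hexCenter_sub_down _).1] at hdir
      have h := congrArg Complex.re hdir; norm_num at h
    · rw [(hexCenter_sub_down _).2.1] at hdir
      have h := congrArg Complex.re hdir; norm_num at h
    · rw [(hexCenter_sub_down _).2.2] at hdir
      have h := congrArg Complex.im hdir; norm_num at h; linarith
  · exact absurd hadj (not_hexGraph_adj_of_snd_eq_holds _ _ rfl)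

/-- **A dart heading `-30°` is a dart of a column of form `3`**: if `c_t - c_v = -(1/√3)·n₃` for
adjacent faces `v, t`, then `v = (c,y,1)` and `t = (c+1,y,0)`. [folklore] -/
theorem dart_coord_three {v t : HexVertex} (hadj : hexGraph.Adj v t)
    (hdir : hexCenter t - hexCenter v = -((1 / Real.sqrt 3 : ℝ) : ℂ) * innerNormal 3) :
    ∃ c y : ℤ, v = (![c, y], 1) ∧ t = (![c + 1, y], 0) := by
  have h3 : 0 < Real.sqrt 3 := Real.sqrt_pos.2 (by norm_num)
  rw [one_div, neg_inv_sqrt_three_mul_innerNormal] at hdir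
  simp only [Matrix.cons_val] at hdir
  obtain ⟨x, i⟩ := v
  obtain ⟨y, l⟩ := t
  obtain ⟨j, m, rfl⟩ : ∃ j m : ℤ, x = ![j, m] := ⟨x 0, x 1, by rw [site_two_eq_iff]; simp⟩
  fin_cases i <;> fin_cases l <;> simp only [Fin.zero_eta, Fin.mk_one, Fin.isValue] at hadj hdir ⊢
  · exact absurd hadj (not_hexGraph_adj_of_snd_eq_holds _ _ rfl)
  · rcases (hexGraph_adj_iff_of_snd_eq_zero_holds _ y).1 hadj with rfl | rfl | rfl
    · rw [(hexCenter_sub_up _).1] at hdir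
      have h := congrArg Complex.im hdir; norm_num at h; linarith
    · rw [(hexCenter_sub_up _).2.1] at hdir
      have h := congrArg Complex.re hdir; norm_num at h
    · rw [(hexCenter_sub_up _).2.2] at hdir
      have h := congrArg Complex.re hdir; norm_num at h
  · rcases (hexGraph_adj_iff_of_snd_eq_one _ y).1 hadj with rfl | rfl | rfl
    · rw [(hexCenter_sub_down _).1] at hdir
      have h := congrArg Complex.re hdir; norm_num at h
    · exact ⟨j, m, rfl, Prod.ext (by rw [site_two_eq_iff]; simp) rfl⟩
    · rw [(hexCenter_sub_down _).2.2] at hdir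
      have h := congrArg Complex.re hdir; norm_num at h
  · exact absurd hadj (not_hexGraph_adj_of_snd_eq_holds _ _ rfl)

/-- **A dart heading `150°` is a dart of a column of form `2`**: if `c_t - c_v = -(1/√3)·n₂` for
adjacent faces `v, t`, then `v = (c,y,0)` and `t = (c-1,y,1)`. [folklore] -/
theorem dart_coord_two {v t : HexVertex} (hadj : hexGraph.Adj v t)
    (hdir : hexCenter t - hexCenter v = -((1 / Real.sqrt 3 : ℝ) : ℂ) * innerNormal 2) :
    ∃ c y : ℤ, v = (![c, y], 0) ∧ t = (![c - 1, y], 1) := by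
  have h3 : 0 < Real.sqrt 3 := Real.sqrt_pos.2 (by norm_num)
  rw [one_div, neg_inv_sqrt_three_mul_innerNormal] at hdir
  simp only [Matrix.cons_val] at hdir
  obtain ⟨x, i⟩ := v
  obtain ⟨y, l⟩ := t
  obtain ⟨j, m, rfl⟩ : ∃ j m : ℤ, x = ![j, m] := ⟨x 0, x 1, by rw [site_two_eq_iff]; simp⟩
  fin_cases i <;> fin_cases l <;> simp only [Fin.zero_eta, Fin.mk_one, Fin.isValue] at hadj hdir ⊢
  · exact absurd hadj (not_hexGraph_adj_of_snd_eq_holds _ _ rfl)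
  · rcases (hexGraph_adj_iff_of_snd_eq_zero_holds _ y).1 hadj with rfl | rfl | rfl
    · rw [(hexCenter_sub_up _).1] at hdir
      have h := congrArg Complex.re hdir; norm_num at h
    · exact ⟨j, m, rfl, Prod.ext (by rw [site_two_eq_iff]; simp) rfl⟩
    · rw [(hexCenter_sub_up _).2.2] at hdir
      have h := congrArg Complex.re hdir; norm_num at h
  · rcases (hexGraph_adj_iff_of_snd_eq_one _ y).1 hadj with rfl | rfl | rfl
    · rw [(hexCenter_sub_down _).1] at hdir
      have h := congrArg Complex.im hdir; norm_num at h; linarith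
    · rw [(hexCenter_sub_down _).2.1] at hdir
      have h := congrArg Complex.re hdir; norm_num at h
    · rw [(hexCenter_sub_down _).2.2] at hdir
      have h := congrArg Complex.re hdir; norm_num at h
  · exact absurd hadj (not_hexGraph_adj_of_snd_eq_holds _ _ rfl)

/-! ### 4. The faces near a dart of the three sides -/

/-- **Faces at a floor dart**: if the midpoint of the floor dart below `(k,l,0)` lies in
`ball x (r - 4)`, the up face, the face below and the down face `(k,l,1)` have centres in
`ball x r`. [folklore] -/
theorem near_floor {x : ℂ} {r : ℝ} {k l : ℤ}
    (h : hexMidpoint s(((![k, l - 1], 1) : HexVertex), ((![k, l], 0) : HexVertex)) ∈ Metric.ball x (r - 4)) :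
    hexCenter ((![k, l], 0) : HexVertex) ∈ Metric.ball x r ∧
    hexCenter ((![k, l - 1], 1) : HexVertex) ∈ Metric.ball x r ∧
    hexCenter ((![k, l], 1) : HexVertex) ∈ Metric.ball x r := by
  have h0 := dist_hexCenter_hexMidpoint_mk_le (hexGraph_adj_dn k l).symm (Or.inr rfl)
  have h1 := dist_hexCenter_hexMidpoint_mk_le (hexGraph_adj_dn k l).symm (Or.inl rfl)
  refine ⟨mem_ball_of_dist_le h (h0.trans (by norm_num)), mem_ball_of_dist_le h (h1.trans (by norm_num)),
    mem_ball_of_dist_le h ?_⟩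
  linarith [dist_triangle (hexCenter ((![k, l], 1) : HexVertex)) (hexCenter ((![k, l], 0) : HexVertex))
    (hexMidpoint s(((![k, l - 1], 1) : HexVertex), ((![k, l], 0) : HexVertex))),
    dist_hexCenter_le_of_adj (hexGraph_adj_up k l).symm]

/-- **Faces at a dart of a column of form `3`**: if the midpoint of the dart at `(k,l,1)` lies in
`ball x (r - 4)`, the dart face, its far end `(k+1,l,0)` and the connector `(k,l+1,0)` have
centres in `ball x r`. [folklore] -/
theorem near_side3 {x : ℂ} {r : ℝ} {k l : ℤ}
    (h : hexMidpoint s(((![k + 1, l], 0) : HexVertex), ((![k, l], 1) : HexVertex)) ∈ Metric.ball x (r - 4)) :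
    hexCenter ((![k, l], 1) : HexVertex) ∈ Metric.ball x r ∧
    hexCenter ((![k + 1, l], 0) : HexVertex) ∈ Metric.ball x r ∧
    hexCenter ((![k, l + 1], 0) : HexVertex) ∈ Metric.ball x r := by
  have h0 := dist_hexCenter_hexMidpoint_mk_le (hexGraph_adj_e0 k l).symm (Or.inr rfl)
  have h1 := dist_hexCenter_hexMidpoint_mk_le (hexGraph_adj_e0 k l).symm (Or.inl rfl)
  refine ⟨mem_ball_of_dist_le h (h0.trans (by norm_num)), mem_ball_of_dist_le h (h1.trans (by norm_num)),
    mem_ball_of_dist_le h ?_⟩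
  linarith [dist_triangle (hexCenter ((![k, l + 1], 0) : HexVertex)) (hexCenter ((![k, l], 1) : HexVertex))
    (hexMidpoint s(((![k + 1, l], 0) : HexVertex), ((![k, l], 1) : HexVertex))),
    dist_hexCenter_le_of_adj (hexGraph_adj_e1 k l).symm]

/-- **Faces at a dart of a column of form `2`**: if the midpoint of the dart at `(k,l,0)` lies in
`ball x (r - 4)`, the dart face, its far end `(k-1,l,1)` and the connector `(k,l,1)` have centres
in `ball x r`. [folklore] -/
theorem near_side2 {x : ℂ} {r : ℝ} {k l : ℤ}
    (h : hexMidpoint s(((![k - 1, l], 1) : HexVertex), ((![k, l], 0) : HexVertex)) ∈ Metric.ball x (r - 4)) :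
    hexCenter ((![k, l], 0) : HexVertex) ∈ Metric.ball x r ∧
    hexCenter ((![k - 1, l], 1) : HexVertex) ∈ Metric.ball x r ∧
    hexCenter ((![k, l], 1) : HexVertex) ∈ Metric.ball x r := by
  have hadj : hexGraph.Adj ((![k - 1, l], 1) : HexVertex) (![k, l], 0) := by
    rw [hexGraph_adj_iff_coord]; simp
  have h0 := dist_hexCenter_hexMidpoint_mk_le hadj (Or.inr rfl)
  have h1 := dist_hexCenter_hexMidpoint_mk_le hadj (Or.inl rfl)
  refine ⟨mem_ball_of_dist_le h (h0.trans (by norm_num)), mem_ball_of_dist_le h (h1.trans (by norm_num)),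
    mem_ball_of_dist_le h ?_⟩
  linarith [dist_triangle (hexCenter ((![k, l], 1) : HexVertex)) (hexCenter ((![k, l], 0) : HexVertex))
    (hexMidpoint s(((![k - 1, l], 1) : HexVertex), ((![k, l], 0) : HexVertex))),
    dist_hexCenter_le_of_adj (hexGraph_adj_up k l).symm]

/-! ### 5. The signed turnings at the corners of forms `(0,3)` and `(0,2)` -/

/-- `arg (n₃ / n₀) = π/3` (`n₃/n₀ = e^{iπ/3}`). [folklore] -/
theorem arg_innerNormal_three_div_zero : Complex.arg (innerNormal 3 / innerNormal 0) = Real.pi / 3 := by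
  have h : innerNormal 3 / innerNormal 0 =
      Complex.cos (Real.pi / 3 : ℝ) + Complex.sin (Real.pi / 3 : ℝ) * Complex.I := by
    rw [← Complex.ofReal_cos, ← Complex.ofReal_sin, Real.cos_pi_div_three, Real.sin_pi_div_three,
      innerNormal_eq]
    simp only [Matrix.cons_val]
    rw [div_eq_iff Complex.I_ne_zero]
    apply Complex.ext <;> simp
  rw [h, Complex.arg_cos_add_sin_mul_I ⟨by linarith [Real.pi_pos], by linarith [Real.pi_pos]⟩]

/-- `arg (n₂ / n₀) = -2π/3` (`n₂/n₀ = e^{-2iπ/3}`). [folklore] -/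
theorem arg_innerNormal_two_div_zero :
    Complex.arg (innerNormal 2 / innerNormal 0) = -(2 * Real.pi / 3) := by
  have hc : Real.cos (-(2 * Real.pi / 3)) = -(1 / 2) := by
    rw [Real.cos_neg, show 2 * Real.pi / 3 = Real.pi - Real.pi / 3 by ring, Real.cos_pi_sub,
      Real.cos_pi_div_three]
  have hs : Real.sin (-(2 * Real.pi / 3)) = -(Real.sqrt 3 / 2) := by
    rw [Real.sin_neg, show 2 * Real.pi / 3 = Real.pi - Real.pi / 3 by ring, Real.sin_pi_sub,
      Real.sin_pi_div_three]
  have h : innerNormal 2 / innerNormal 0 =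
      Complex.cos (-(2 * Real.pi / 3) : ℝ) + Complex.sin (-(2 * Real.pi / 3) : ℝ) * Complex.I := by
    rw [← Complex.ofReal_cos, ← Complex.ofReal_sin, hc, hs, innerNormal_eq]
    simp only [Matrix.cons_val]
    rw [div_eq_iff Complex.I_ne_zero]
    apply Complex.ext <;> simp
  rw [h, Complex.arg_cos_add_sin_mul_I ⟨by linarith [Real.pi_pos], by linarith [Real.pi_pos]⟩]

end SidePhaseCorner

/-! ### Registered form -/

/-- **Registered helper `sidePhaseCorner_dart_coord_zero`** (support for `sidePhase_corner`, line
`polygon-parity-squeeze`, crux stmt-CriticalPhenomena-14004): a dart heading `-90°` is a floor dart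
(binder-free form of `SidePhaseCorner.dart_coord_zero`; forms `3`, `2`:
`SidePhaseCorner.dart_coord_three`, `SidePhaseCorner.dart_coord_two`). [folklore] -/
theorem sidePhaseCorner_dart_coord_zero : ∀ (v t : HexVertex), hexGraph.Adj v t → hexCenter t - hexCenter v = -((1 / Real.sqrt 3 : ℝ) : ℂ) * innerNormal 0 → ∃ j m : ℤ, v = (![j, m], 0) ∧ t = (![j, m - 1], 1) :=
  fun _ _ hadj hdir => SidePhaseCorner.dart_coord_zero hadj hdir

end Summit.CriticalPhenomena.SAWScalingLimit.Theorems.PolygonParitySqueeze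

end
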